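import Literature.Probability.Percolation.ArmSeparationOutCoverFour
import Literature.Probability.Percolation.ArmSeparationOutExtFour
import Literature.Probability.Percolation.ArmSeparationSepInitFour
import Literature.Probability.Percolation.ArmSeparationFinalProofs
import HarnessLib

/-!
# The external half of the four-arm separation theorem, at `p` (the outer multi-scale scheme)

Topic `Literature/Probability/Percolation`; family `crit-perc` / near-critical percolation on `𝕋`.
A brick of the near-critical arm-separation theorem for four arms of alternating colours
(P. Nolin, *Near-critical percolation in two dimensions*, EJP 13 (2008), Thm. 11 for `j = 4`,
`σ = BWBW` [arXiv 0711.4948: Thm. 10], §4.4 pp. 11–13, external extremities; "uniformly in `p`"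
below the characteristic length): the four alternating arms crossing `{n ≤ |v| ≤ N}`
(`altFourArm n N`) can be required to land fenced and separated on the sides `0, 2, 3, 5` of
`∂Λ_N` (`extFourArmQ n N`) at constant cost,

  `P_p(altFourArm n N) ≤ C · P_p(extFourArmQ n N)`  for `n ≥ n₀`, `N ≥ 2n`, `N ≤ Ncap`,

at every parameter `p` at which the frame-continuation input `hF` (open/closed frames of
probability `≥ c_F`) and the Russo–Seymour–Welsh inputs `hrsw` (aspect ratio `1024`, constant `c`)
and `hrswL` (aspect ratio `256 · 32^K`, constant `c_L`, only for the landing) hold at `p` and at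
`1 - p` for boxes of height `≤ Ncap` — with `C`, `n₀`, `K` depending on `c_F, c, c_L` only. This is
Nolin's induction on the exact doubling ladder `R_K = 2n · 2^K`, `le_mul_of_separationScheme_upto`,
fed with the four-arm bricks at `p`: the surgery step `real_altFourArm_le_outStepFr_at` with the
failure bound `real_not_outGoodFr_le_at`, the landing `real_outMidTiny4_le_at`, the outward
extension `real_extFourArmQ_mul_le_outward_at`, and the initial estimate `pow_le_real_sepFourArmQ_at`.

* `orung_Gr7_le`, `orung_aspect7`, `orung_slots_le` — the outer rung's level-`7` ring and slot count
  are bounded in terms of `D, K` only;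
* `exists_real_altFourArm_le_mul_extFourArmQ_at` — the theorem.

Everything here is proved; no named facts are introduced.

## References

* P. Nolin, Near-critical percolation in two dimensions, *Electron. J. Probab.* 13 (2008), §4.4
  Thm. 11 (arXiv 0711.4948: Thm. 10, pp. 11–13), external extremities [Nolin2008].
* H. Kesten, Scaling relations for 2D-percolation, *Comm. Math. Phys.* 109 (1987), Lemma 2 [Kesten1987].
-/

noncomputable section

open MeasureTheory Set

namespace Literature.Probability.Percolation

open LatticeModels

/-! ### The outer rung: bounds in terms of `D, K` -/

/-- **The level-`7` ring of the outer rung is short**: `Gr 7 ≤ 49 D` for `D ≥ 256 · 32^K`, `M ≥ 64 D`. [folklore] -/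
theorem orung_Gr7_le {M n D K : ℕ} (hD : 256 * 32 ^ K ≤ D) (hM : 64 * D ≤ M) :
    (⟨M, n, M / D, K, 8 * trapScale (M / D) K⟩ : OParams).Gr 7 ≤ 49 * D := by
  have hX : 1 ≤ 32 ^ K := Nat.one_le_pow _ _ (by norm_num)
  have hD1 : 1 ≤ D := by omega
  have hk : 64 ≤ M / D := (Nat.le_div_iff_mul_le (by omega)).2 (by linarith)
  have hlt : M < D * (M / D) + D := by
    have := Nat.lt_div_mul_add (a := M) hD1; linarith [Nat.mul_comm (M / D) D]
  set k₀ := M / D with hk₀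
  have h15 : 15 * 32 ^ K ≤ D := by omega
  show 12 * ((k₀ * ((2 * M + (2 * 7 + 1) * (k₀ * 32 ^ K)) / k₀) + k₀) / k₀) - 4 ≤ 49 * D
  have hk0 : 0 < k₀ := by omega
  have e1 : (k₀ * ((2 * M + (2 * 7 + 1) * (k₀ * 32 ^ K)) / k₀) + k₀) / k₀ = (2 * M + (2 * 7 + 1) * (k₀ * 32 ^ K)) / k₀ + 1 := by
    rw [show k₀ * ((2 * M + (2 * 7 + 1) * (k₀ * 32 ^ K)) / k₀) + k₀ = k₀ * ((2 * M + (2 * 7 + 1) * (k₀ * 32 ^ K)) / k₀ + 1) by ring,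
      Nat.mul_div_cancel_left _ hk0]
  have e2 : (2 * M + (2 * 7 + 1) * (k₀ * 32 ^ K)) / k₀ = 2 * M / k₀ + 15 * 32 ^ K := by
    rw [show (2 * 7 + 1) * (k₀ * 32 ^ K) = k₀ * (15 * 32 ^ K) by ring, Nat.add_mul_div_left _ _ hk0]
  have e3 : 2 * M / k₀ ≤ 3 * D := by
    apply Nat.div_le_of_le_mul
    nlinarith
  rw [e1, e2]
  omega

/-- **The spokes of the outer rung fit RSW at aspect ratio `256 · 32^K`**:
`LL 7 + μ ≤ 256 · 32^K · (2ε)` for `D ≥ 256 · 32^K`, `M ≥ 64 D`. [folklore] -/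
theorem orung_aspect7 {M n D K : ℕ} (hD : 256 * 32 ^ K ≤ D) (hM : 64 * D ≤ M) :
    (⟨M, n, M / D, K, 8 * trapScale (M / D) K⟩ : OParams).LL 7 + (⟨M, n, M / D, K, 8 * trapScale (M / D) K⟩ : OParams).μ ≤
      256 * 32 ^ K * (2 * (⟨M, n, M / D, K, 8 * trapScale (M / D) K⟩ : OParams).ε) := by
  have hX : 1 ≤ 32 ^ K := Nat.one_le_pow _ _ (by norm_num)
  have hD1 : 1 ≤ D := by omega
  have hk : 64 ≤ M / D := (Nat.le_div_iff_mul_le (by omega)).2 (by linarith)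
  set k₀ := M / D with hk₀
  set X := 32 ^ K with hXd
  show (2 * 7 + 1) * (k₀ * X) + 2 * k₀ + 4 * (k₀ / 4) + k₀ * X ≤ 256 * X * (2 * (k₀ / 16))
  have h4 : 4 * (k₀ / 4) ≤ k₀ := Nat.mul_div_le k₀ 4
  have h16 : k₀ ≤ 16 * (k₀ / 16) + 15 := by omega
  set f := k₀ / 16 with hf
  have hXf : X * k₀ ≤ 16 * (X * f) + 15 * X := by nlinarith
  have hkey : 480 * X + 3 * k₀ ≤ 16 * (X * k₀) := by nlinarith
  nlinarith

/-- **The slot count of the outer rung is bounded in terms of `D, K`**: with `Nw ≤ 10 D` and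
`Gr 7 ≤ 49 D`, `∏_q slot4Bound ^ 4 ≤ (6 K (10D) 5 · 8 (49D+1)²)⁴`. [folklore] -/
theorem orung_slots_le {M n D K : ℕ} (hD : 256 * 32 ^ K ≤ D) (hM : 64 * D ≤ M) :
    (∏ q : Fin 7, slot4Bound (⟨M, n, M / D, K, 8 * trapScale (M / D) K⟩ : OParams) q ^ 4 : ℕ) ≤
      (6 * K * (10 * D) * 5 * 8 * (49 * D + 1) * (49 * D + 1)) ^ 4 := by
  set P : OParams := ⟨M, n, M / D, K, 8 * trapScale (M / D) K⟩ with hP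
  have hD1 : 1 ≤ D := by have h1 : 1 ≤ 32 ^ K := Nat.one_le_pow _ _ (by norm_num); omega
  have hNw : P.Nw ≤ 10 * D := orung_Nw_le (n := n) (K := K) hD1 hM
  have hG7 : P.Gr 7 ≤ 49 * D := orung_Gr7_le (n := n) hD hM
  rw [Finset.prod_pow]
  apply Nat.pow_le_pow_left
  rw [Fin.prod_univ_seven]
  show 6 * P.K * P.Nw * 5 * 8 * (P.Gr 7 + 1) * (P.Gr 7 + 1) ≤ 6 * K * (10 * D) * 5 * 8 * (49 * D + 1) * (49 * D + 1)
  have hK : P.K = K := rfl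
  rw [hK]
  gcongr

/-! ### The external half at `p` -/

/-- **The external half of the four-arm separation theorem at `p`** (Nolin 2008, Thm. 11 for
`j = 4`, `σ = BWBW`, external extremities, "uniformly in `p`"): for constants `c_F ∈ (0, 1]`
(frames) and `c ∈ (0, 1]` (RSW at aspect ratio `1024`) there is a number of scales `K`, and then for
every `c_L ∈ (0, 1]` (RSW at aspect ratio `256 · 32^K`, used only by the landing) there are
`C > 0` and `n₀` such that at every parameter `p` at which the three inputs hold at `p` and at
`1 - p` for boxes of height `≤ Ncap`,
`P_p(altFourArm n N) ≤ C · P_p(extFourArmQ n N)` for all `n ≥ n₀`, `2n ≤ N ≤ Ncap`. Nolin's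
induction of §4.4 on the external extremities, on the exact doubling ladder `R_K = 2n · 2^K`
(`le_mul_of_separationScheme_upto`). [cite: Nolin2008, §4.4 Thm. 11 (arXiv 0711.4948: Thm. 10, pp. 11–13), external extremities; Kesten1987, Lemma 2] -/
theorem exists_real_altFourArm_le_mul_extFourArmQ_at {cF c : ℝ} (hcF : 0 < cF) (hcF1 : cF ≤ 1) (hc : 0 < c) (hc1 : c ≤ 1) :
    ∃ K : ℕ, ∀ cL : ℝ, 0 < cL → cL ≤ 1 → ∃ C : ℝ, 0 < C ∧ ∃ n₀ : ℕ, ∀ (p : unitInterval) (Ncap : ℕ),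
      (∀ q : unitInterval, (q = p ∨ q = unitInterval.symm p) →
        ∀ (z : Site 2) (k : ℕ), 1 ≤ k → k ≤ Ncap → cF ≤ (triSitePercolation q).real (triFrameAt z k)) →
      (∀ q : unitInterval, (q = p ∨ q = unitInterval.symm p) →
        ∀ k : ℕ, 1 ≤ ⌊((1024 : ℕ) : ℝ) * k⌋₊ → k ≤ Ncap → c ≤ triLRCrossingProb q ⌊((1024 : ℕ) : ℝ) * k⌋₊ k) →
      (∀ q : unitInterval, (q = p ∨ q = unitInterval.symm p) →
        ∀ k : ℕ, 1 ≤ ⌊((256 * 32 ^ K : ℕ) : ℝ) * k⌋₊ → k ≤ Ncap → cL ≤ triLRCrossingProb q ⌊((256 * 32 ^ K : ℕ) : ℝ) * k⌋₊ k) →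
      ∀ n N : ℕ, n₀ ≤ n → 2 * n ≤ N → N ≤ Ncap →
        (triSitePercolation p).real (altFourArm n N) ≤ C * (triSitePercolation p).real (extFourArmQ n N) := by
  -- the constants
  set a : ℝ := 1 - c with ha
  set b : ℝ := 1 - cF ^ 2 with hb
  have ha0 : 0 ≤ a := by rw [ha]; linarith
  have ha1 : a < 1 := by rw [ha]; linarith
  have hb0 : 0 ≤ b := by rw [hb]; linarith [pow_le_one₀ hcF.le hcF1 (n := 2)]
  have hb1 : b < 1 := by rw [hb]; linarith [pow_pos hcF 2]
  have hq95 : 0 < (c ^ 95) ^ 4 := by positivity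
  set C₀ : ℝ := 1 / (c ^ 95) ^ 4 with hC₀def
  have hC₀ : 1 ≤ C₀ := by
    rw [hC₀def, le_div_iff₀ hq95, one_mul]
    calc (c ^ 95) ^ 4 ≤ (1 : ℝ) ^ 4 := by gcongr; exact pow_le_one₀ hc.le hc1
      _ = 1 := one_pow 4
  have hC₀0 : 0 < C₀ := lt_of_lt_of_le one_pos hC₀
  obtain ⟨T, K, Kg, hK1, hsmall⟩ := exists_scheme_constants ha0 ha1 hb0 hb1 hC₀
  refine ⟨K, fun cL hcL hcL1 => ?_⟩
  set ε : ℝ := 12 * (a ^ (T + 1) + T * b ^ K + 2 * b ^ Kg) with hε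
  have hε0 : 0 ≤ ε := by positivity
  have hεC : ε * C₀ ^ 2 ≤ 1 / 2 := by rw [hε]; exact hsmall
  set D : ℕ := 256 * 32 ^ (K + Kg) with hD
  have hDK : 256 * 32 ^ K ≤ D := by
    rw [hD, pow_add]; exact Nat.mul_le_mul_left _ (Nat.le_mul_of_pos_right _ (Nat.one_le_pow _ _ (by norm_num)))
  have hD1 : 1 ≤ D := le_trans (Nat.one_le_pow K 32 (by norm_num)) (le_trans (Nat.le_mul_of_pos_left _ (by norm_num)) hDK)
  set ci : ℝ := (c ^ 5) ^ 4 with hci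
  have hci0 : 0 < ci := by positivity
  set Bg : ℕ := 49 * D with hBg
  set Nsl : ℕ := (6 * K * (10 * D) * 5 * 8 * (49 * D + 1) * (49 * D + 1)) ^ 4 with hNsl
  set qL : ℝ := (cF * cL ^ (Bg + 3)) ^ 4 with hqL
  have hqL0 : 0 < qL := by positivity
  set C₁ : ℝ := Nsl / qL with hC₁
  have hC₁0 : 0 ≤ C₁ := by positivity
  set Cs : ℝ := 2 * C₁ + 1 / ci with hCs
  have hCs0 : 0 < Cs := by positivity
  refine ⟨Cs * C₀ + 1 / ci, by positivity, 32 * D + 1100, fun p Ncap hF hrsw hrswL n N hn hN hcapN => ?_⟩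
  have hn1100 : 1100 ≤ n := le_trans (Nat.le_add_left _ _) hn
  have hnD : 32 * D ≤ n := le_trans (Nat.le_add_right _ _) hn
  set μ := triSitePercolation p with hμ
  have hP1 : ∀ s : Set (SiteConfig (Site 2)), μ.real s ≤ 1 := fun s => measureReal_le_one
  have hP0 : ∀ s : Set (SiteConfig (Site 2)), 0 ≤ μ.real s := fun s => measureReal_nonneg
  have hρ1024 : (64 : ℕ) ≤ 1024 := by norm_num
  have hsepext : ∀ R, 2 * n ≤ R → μ.real (sepFourArmQ n R) ≤ μ.real (extFourArmQ n R) := fun R hR =>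
    measureReal_mono (sepFourArmQ_subset_extFourArmQ hR) (measure_ne_top _ _)
  have hinit : ∀ N', 2 * n ≤ N' → N' ≤ 10 * n → N' ≤ Ncap → ci ≤ μ.real (extFourArmQ n N') := fun N' h1 h2 h3 =>
    (pow_le_real_sepFourArmQ_at p hrsw le_rfl hc.le hn1100 h1 h2 h3).trans (hsepext N' h1)
  -- small `N`: the initial estimate alone
  by_cases hsmallN : N < 8 * n
  · have h1 : ci ≤ μ.real (extFourArmQ n N) := hinit N hN (by omega) hcapN
    have h2 : 1 ≤ 1 / ci * μ.real (extFourArmQ n N) := by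
      rw [one_div, inv_mul_eq_div, le_div_iff₀ hci0]; linarith
    calc μ.real (altFourArm n N) ≤ 1 := hP1 _
      _ ≤ 1 / ci * μ.real (extFourArmQ n N) := h2
      _ ≤ (Cs * C₀ + 1 / ci) * μ.real (extFourArmQ n N) := by
          have := hP0 (extFourArmQ n N); have : 0 ≤ Cs * C₀ := by positivity
          nlinarith
  push Not at hsmallN
  -- the ladder `ρ K' = 2n · 2^K'` and its top `L ≥ 1` with `2 ρ L ≤ N < 4 ρ L`
  set ρ : ℕ → ℕ := fun K' => 2 * n * 2 ^ K' with hρ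
  have hρsucc : ∀ K', ρ (K' + 1) = 2 * ρ K' := fun K' => by simp only [hρ, pow_succ]; ring
  have hρn : ∀ K', 2 * n ≤ ρ K' := fun K' => by
    simp only [hρ]; exact Nat.le_mul_of_pos_right _ (Nat.one_le_two_pow)
  have hρmono : ∀ K', ρ K' ≤ ρ (K' + 1) := fun K' => by rw [hρsucc]; omega
  have hex : ∃ j, N < 2 * ρ (j + 1) := by
    refine ⟨N, ?_⟩
    simp only [hρ]
    have h2 : N + 1 < 2 ^ (N + 1) := Nat.lt_two_pow_self
    have h3 : 1 ≤ 2 * n := by omega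
    calc N < 2 ^ (N + 1) := by omega
      _ ≤ 2 * n * 2 ^ (N + 1) := Nat.le_mul_of_pos_left _ h3
      _ ≤ 2 * (2 * n * 2 ^ (N + 1)) := Nat.le_mul_of_pos_left _ (by norm_num)
  classical
  set L := Nat.find hex with hL
  have hLspec : N < 2 * ρ (L + 1) := Nat.find_spec hex
  have hL1 : 1 ≤ L := by
    by_contra h
    have hL0 : L = 0 := by omega
    rw [hL0, zero_add] at hLspec
    simp only [hρ, pow_one] at hLspec
    omega
  have hLle : 2 * ρ L ≤ N := by
    have := Nat.find_min hex (show L - 1 < L by omega)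
    rw [show L - 1 + 1 = L by omega] at this
    omega
  have hρLN : ρ L ≤ N := by omega
  have hNρ : N ≤ 32 * ρ L := by rw [hρsucc] at hLspec; omega
  have hρL_le : ∀ K', K' ≤ L → ρ K' ≤ ρ L := fun K' hK' => by
    simp only [hρ]; exact Nat.mul_le_mul_left _ (Nat.pow_le_pow_right (by norm_num) hK')
  -- the frame and RSW inputs at the scales of the ladder
  have hFM : ∀ M, M ≤ N → ∀ q : unitInterval, (q = p ∨ q = unitInterval.symm p) →
      ∀ (z : Site 2) (k : ℕ), 1 ≤ k → k < M → cF ≤ (triSitePercolation q).real (triFrameAt z k) :=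
    fun M hM q hq z k hk hkM => hF q hq z k hk (by omega)
  have hfl : ∀ k : ℕ, ⌊((1024 : ℕ) : ℝ) * (k : ℕ)⌋₊ = 1024 * k := fun k => by
    have : ((1024 : ℕ) : ℝ) * (k : ℕ) = ((1024 * k : ℕ) : ℝ) := by push_cast; ring
    rw [this, Nat.floor_natCast]
  have hc4 : ∀ M, 2 ≤ M → M ≤ N → ∀ q : unitInterval, (q = p ∨ q = unitInterval.symm p) →
      c ≤ triLRCrossingProb q (4 * (M - 1)) (M - 1) := fun M hM hMN q hq => by
    have h := hrsw q hq (M - 1) (by rw [hfl]; omega) (by omega)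
    rw [hfl] at h
    exact h.trans (triLRCrossingProb_anti_width q (by omega) _)
  -- the three sequences
  set oP : ℕ → OParams := fun M => ⟨M, n, M / D, K, 8 * trapScale (M / D) K⟩ with hoP
  set f : ℕ → ℝ := fun K' => μ.real (altFourArm n (ρ K')) with hf
  set g : ℕ → ℝ := fun K' => μ.real (OutMidTiny4 (ρ (K' - 1)) n (ρ (K' - 1) / D) K (8 * trapScale (ρ (K' - 1) / D) K)) with hg
  set h : ℕ → ℝ := fun K' => μ.real (extFourArmQ n (ρ K')) with hh
  have key := le_mul_of_separationScheme_upto (f := f) (g := g) (h := h) (k := 0) (L := L) hε0 hC₀ hC₁0 hci0 hεC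
    (fun K' => hP1 _) (fun K' => hP0 _) (by omega)
    (fun K' _ _ => measureReal_mono (altFourArm_anti n (by have := hρn K'; omega) (hρmono K')) (measure_ne_top _ _))
    (fun K' _ hK'L => by
      -- the surgery step at half-radius `M = ρ K'`, `2M = ρ (K'+1)`
      have hM : 64 * D ≤ ρ K' := by have := hρn K'; omega
      obtain ⟨gR, gRg, gKM, gk₀, gM3⟩ := orung_guards (K := K) (Kg := Kg) hD hM
      have hnM : n ≤ ρ K' := by have := hρn K'; omega
      have hMN : ρ K' ≤ N := (hρL_le K' (by omega)).trans hρLN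
      have hR₀ : 1 ≤ 8 * trapScale (ρ K' / D) K := by
        have := le_trapScale (ρ K' / D) K; omega
      have step := real_altFourArm_le_outStepFr_at p (T := T) (Kg := Kg) (R := ρ K' - 1) (Rg := ρ K' - 1) (by omega)
        (by omega) hnM hR₀ gR (by omega) gRg (by omega)
      have bad := real_not_outGoodFr_le_at p (S := ρ K') hcF hcF1 (hFM (ρ K') hMN) (hFM (ρ K') hMN) gM3
        (hc4 (ρ K') (by omega) hMN) (T := T) (Kg := Kg) gk₀ hR₀ gKM (fun i hi => by have := gRg i hi; omega)
      rw [← ha, ← hb] at bad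
      have hbad' : μ.real {ω | ¬ OutGoodFr (ρ K') T (ρ K' / D) K (8 * trapScale (ρ K' / D) K) Kg ω} ≤ ε := by rw [hε]; exact bad
      have hgK : μ.real (OutMidTiny4 (ρ K') n (ρ K' / D) K (8 * trapScale (ρ K' / D) K)) = g (K' + 1) := by
        simp only [hg, Nat.add_sub_cancel]
      have hfK : 0 ≤ f K' := hP0 _
      have hbf := mul_le_mul_of_nonneg_right hbad' hfK
      show μ.real (altFourArm n (ρ (K' + 1))) ≤ g (K' + 1) + ε * μ.real (altFourArm n (ρ K'))
      rw [hρsucc, ← hgK]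
      linarith [step, hbf])
    (fun K' hK' hK'L => by
      -- the landing inequality at half-radius `ρ (K'-1)`: `4 ρ (K'-1) = ρ (K'+1)`
      have hM : 64 * D ≤ ρ (K' - 1) := by have := hρn (K' - 1); omega
      have hnM : n ≤ ρ (K' - 1) := by have := hρn (K' - 1); omega
      have hV := orung_valid (n := n) hK1 hDK hM hnM
      have h4 : 4 * ρ (K' - 1) = ρ (K' + 1) := by
        rw [show K' + 1 = (K' - 1) + 1 + 1 by omega, hρsucc, hρsucc]; ring
      have hMN : ρ (K' + 1) ≤ N := (hρL_le (K' + 1) hK'L).trans hρLN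
      have hX : 1 ≤ 32 ^ K := Nat.one_le_pow _ _ (by norm_num)
      have hcap : (oP (ρ (K' - 1))).N' / 16 ≤ Ncap := by
        show 4 * ρ (K' - 1) / 16 ≤ Ncap; omega
      have hland := real_outMidTiny4_le_at hV p hF hrswL (ρ := 256 * 32 ^ K) (by omega) hcL.le hcF.le
        (orung_aspect7 (n := n) hDK hM) hcap (orung_Gr7_le (n := n) hDK hM)
      have hslots := orung_slots_le (n := n) (M := ρ (K' - 1)) hDK hM
      have hsl : ((∏ q : Fin 7, slot4Bound (oP (ρ (K' - 1))) q ^ 4 : ℕ) : ℝ) ≤ (Nsl : ℝ) := by exact_mod_cast hslots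
      show μ.real (OutMidTiny4 (ρ (K' - 1)) n (ρ (K' - 1) / D) K (8 * trapScale (ρ (K' - 1) / D) K)) ≤
        C₁ * μ.real (extFourArmQ n (ρ (K' + 1)))
      rw [← h4, hC₁, div_mul_eq_mul_div, le_div_iff₀ hqL0]
      calc μ.real (OutMidTiny4 (ρ (K' - 1)) n (ρ (K' - 1) / D) K (8 * trapScale (ρ (K' - 1) / D) K)) * qL
          ≤ (∏ q : Fin 7, slot4Bound (oP (ρ (K' - 1))) q ^ 4 : ℕ) * μ.real (extFourArmQ n (4 * ρ (K' - 1))) := hland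
        _ ≤ (Nsl : ℝ) * μ.real (extFourArmQ n (4 * ρ (K' - 1))) := mul_le_mul_of_nonneg_right hsl (hP0 _))
    (fun K' hK' hK'L => by
      -- the outward extension from `ρ K'` to `ρ (K'+1) = 2 ρ K'`
      have h2200 : 2200 ≤ ρ K' := by have := hρn K'; omega
      have hMN : ρ (K' + 1) ≤ N := (hρL_le (K' + 1) hK'L).trans hρLN
      have h1 := real_extFourArmQ_mul_le_outward_at p hrsw hρ1024 hc.le h2200 (hρn K') (by rw [hρsucc]) (by rw [hρsucc]; omega)
        (hMN.trans hcapN)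
      show μ.real (extFourArmQ n (ρ K')) ≤ C₀ * μ.real (extFourArmQ n (ρ (K' + 1)))
      rw [hC₀def, one_div, ← div_eq_inv_mul, le_div_iff₀ hq95]
      exact h1)
    (by
      -- the initial estimate at `ρ 1 = 4n`
      show ci ≤ μ.real (extFourArmQ n (ρ (0 + 1)))
      have hρ1 : ρ (0 + 1) = 4 * n := by simp only [hρ, zero_add, pow_one]; ring
      rw [hρ1]
      have h41 : ρ 1 ≤ N := (hρL_le 1 hL1).trans hρLN
      have hρ1' : ρ 1 = 4 * n := by simp only [hρ, pow_one]; ring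
      exact hinit (4 * n) (by omega) (by omega) (by rw [← hρ1']; exact h41.trans hcapN))
    L hL1 le_rfl
  simp only [hf, hh] at key
  -- from `ρ L` to `N`
  have h2200 : 2200 ≤ ρ L := by have := hρn L; omega
  have e1 : μ.real (altFourArm n N) ≤ μ.real (altFourArm n (ρ L)) :=
    measureReal_mono (altFourArm_anti n (by have := hρn L; omega) hρLN) (measure_ne_top _ _)
  have e2 := real_extFourArmQ_mul_le_outward_at p hrsw hρ1024 hc.le h2200 (hρn L) hLle hNρ hcapN
  have e2' : μ.real (extFourArmQ n (ρ L)) ≤ C₀ * μ.real (extFourArmQ n N) := by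
    rw [hC₀def, one_div, ← div_eq_inv_mul, le_div_iff₀ hq95]; exact e2
  have e3 : 0 ≤ μ.real (extFourArmQ n N) := hP0 _
  calc μ.real (altFourArm n N) ≤ Cs * μ.real (extFourArmQ n (ρ L)) := e1.trans key
    _ ≤ Cs * (C₀ * μ.real (extFourArmQ n N)) := mul_le_mul_of_nonneg_left e2' hCs0.le
    _ ≤ (Cs * C₀ + 1 / ci) * μ.real (extFourArmQ n N) := by
        have : 0 ≤ 1 / ci * μ.real (extFourArmQ n N) := by positivity
        nlinarith

end Literature.Probability.Percolation
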